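import Literature.NumberTheory.EllipticCurves.LocalEulerFactorModel
import Literature.NumberTheory.EllipticCurves.LFunctionSmulProofs
import HarnessLib

/-!
# Bookkeeping for the local factors of the CM isogeny classes

Sibling file of `Literature.NumberTheory.EllipticCurves.LocalEulerFactorModel` (D-0014 append
protocol; everything here is proved, no definitions). Small shared lemmas used by the four files
`ComplexMultiplicationLocalFactors16/12/28/27`, which prove Knapp's Theorem 11.67 ("isogenous
curves over `ℚ` have the same `L`-function", *Elliptic Curves*, p. 281) for the four CM isogeny
classes `j = 287496 ~ 1728`, `54000 ~ 0`, `16581375 ~ -3375`, `-12288000 ~ 0` and all their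
quadratic twists, prime by prime:

* valuations of integers at a finite place of `ℚ` (`Rat.valuation_cube_le_of_dvd`, the prime `p_v`
  as an integer prime, squarefree bookkeeping);
* `hasAdditiveReductionAt_map_of_data`: additive reduction of a `ℤ`-model from `Δ = pⁿm`,
  `c₄ = pᵉk`, `p ∤ m`, `12 ∤ n`, `n ≤ 3e` (Silverman VII.5.1(c) via
  `LocalEulerFactorModel.hasAdditiveReductionAt_map_of_Δ_eq`);
* `natCard_point_eq_one_add_card`: `#W(F) = 1 + #{solutions}` over a finite field, for explicit
  point counts over `𝔽₂` by `decide`;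
* `localPolynomial_two_of_model`: the local polynomial at `2` read off an explicit `2`-integral
  model with odd discriminant (`localPolynomial_smul` and `localPolynomial_map_of_not_dvd`).

## References

* J. H. Silverman, *The Arithmetic of Elliptic Curves*, 2nd ed. (2009), VII.1, VII.5 Prop. 5.1,
  §C.16. [cite: SilvermanAEC2009]
* A. W. Knapp, *Elliptic Curves* (1992), Thm. 11.67 (PDF p. 281). [cite: Knapp1993]
-/

noncomputable section

open scoped Classical

open IsDedekindDomain NumberField Rat.HeightOneSpectrum Polynomial

namespace WeierstrassCurve

/-! ## Valuation bookkeeping for `ℤ`-models over `ℚ` -/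

section Helpers


variable (v : HeightOneSpectrum (𝓞 ℚ))

/-- `|c|_v³ ≤ |Δ|_v` from `p_v^e ∣ c`, `Δ = p_v^n m` (`p_v ∤ m`) and `n ≤ 3e`. [folklore] -/
theorem Rat.valuation_cube_le_of_dvd {c Δ m : ℤ} {e n : ℕ} (hc : (natGenerator v : ℤ) ^ e ∣ c)
    (hΔ : Δ = (natGenerator v : ℤ) ^ n * m) (hm : ¬ ((natGenerator v : ℕ) : ℤ) ∣ m)
    (hne : n ≤ 3 * e) : v.valuation ℚ (c : ℚ) ^ 3 ≤ v.valuation ℚ (Δ : ℚ) := by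
  have h1 : v.valuation ℚ (c : ℚ) ^ 3 ≤ WithZero.exp (-(e : ℤ)) ^ 3 :=
    pow_le_pow_left' (Literature.NumberTheory.GaloisRepresentations.Rat.valuation_intCast_le v hc) 3
  have h2 : v.valuation ℚ (Δ : ℚ) = WithZero.exp (-(n : ℤ)) := by
    rw [hΔ]; push_cast; exact Rat.valuation_pow_mul_intCast v hm n
  rw [h2]
  refine h1.trans ?_
  rw [← WithZero.exp_nsmul, WithZero.exp_le_exp]
  simp only [smul_neg, nsmul_eq_mul, Nat.cast_ofNat, neg_le_neg_iff]
  exact_mod_cast hne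

/-- A prime `p` with `p ∣ d`, `d` squarefree: `d = p d₀` with `p ∤ d₀`. [folklore] -/
theorem Int.exists_eq_mul_not_dvd_of_squarefree {p d : ℤ} (hp : Prime p) (hsq : Squarefree d)
    (h : p ∣ d) : ∃ d₀ : ℤ, d = p * d₀ ∧ ¬ p ∣ d₀ := by
  obtain ⟨d₀, rfl⟩ := h
  refine ⟨d₀, rfl, fun ⟨k, hk⟩ ↦ hp.not_unit (hsq p ⟨k, by rw [hk]; ring⟩)⟩

/-- **Additive reduction of a `ℤ`-model from the data `Δ = p^n m`, `c₄ = p^e k`** with `p ∤ m`,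
`12 ∤ n`, `n ≤ 3e` (so `ord_p(Δ) ∉ 12ℤ` and `ord_p(j) ≥ 0`):
`LocalEulerFactorModel.hasAdditiveReductionAt_map_of_Δ_eq` with the `c₄`-inequality discharged by
divisibility. [cite: SilvermanAEC2009, VII.5 Prop. 5.1(c)] -/
theorem hasAdditiveReductionAt_map_of_data (E : WeierstrassCurve ℤ) {n e : ℕ} {m k : ℤ}
    (hΔ : E.Δ = (natGenerator v : ℤ) ^ n * m) (hm : ¬ ((natGenerator v : ℕ) : ℤ) ∣ m)
    (hn : ¬ 12 ∣ n) (hc : E.c₄ = (natGenerator v : ℤ) ^ e * k) (hne : n ≤ 3 * e) :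
    (E.map (Int.castRingHom ℚ)).HasAdditiveReductionAt v :=
  hasAdditiveReductionAt_map_of_Δ_eq v E hΔ hm hn
    (Rat.valuation_cube_le_of_dvd v (hc ▸ Dvd.intro k rfl) hΔ hm hne)

/-- The prime `p_v` under `v`, as an integer, is prime. [folklore] -/
theorem Rat.prime_natGenerator_int : Prime (natGenerator v : ℤ) :=
  Nat.prime_iff_prime_int.mp (prime_natGenerator v)

/-- If `p_v ≠ q` for a prime `q`, then `p_v ∤ q` in `ℤ`. [folklore] -/
theorem Rat.not_natGenerator_dvd_of_ne {q : ℕ} (hq : q.Prime) (h : natGenerator v ≠ q) :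
    ¬ ((natGenerator v : ℕ) : ℤ) ∣ (q : ℤ) := fun hd ↦
  h ((Nat.prime_dvd_prime_iff_eq (prime_natGenerator v) hq).mp (by exact_mod_cast hd))

/-- If `p_v ∣ q` in `ℤ` for a prime `q`, then `p_v = q`. [folklore] -/
theorem Rat.natGenerator_eq_of_dvd {q : ℕ} (hq : q.Prime) (hd : ((natGenerator v : ℕ) : ℤ) ∣ (q : ℤ)) :
    natGenerator v = q :=
  (Nat.prime_dvd_prime_iff_eq (prime_natGenerator v) hq).mp (by exact_mod_cast hd)


/-- Trichotomy for a prime `p ∣ 6d`: `p ∣ d`, or `p = 2`, or `p = 3`. [folklore] -/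
theorem dvd_or_eq_two_or_eq_three {d : ℤ} (hv : (natGenerator v : ℤ) ∣ 6 * d) :
    (natGenerator v : ℤ) ∣ d ∨ natGenerator v = 2 ∨ natGenerator v = 3 := by
  have hpZ := Rat.prime_natGenerator_int v
  rcases hpZ.dvd_or_dvd hv with h | h
  · rw [show (6 : ℤ) = 2 * 3 by norm_num] at h
    rcases hpZ.dvd_or_dvd h with h | h
    · exact Or.inr (Or.inl (Rat.natGenerator_eq_of_dvd v Nat.prime_two h))
    · exact Or.inr (Or.inr (Rat.natGenerator_eq_of_dvd v Nat.prime_three h))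
  · exact Or.inl h

end Helpers

/-! ## Residues modulo a good prime -/

section Residues

variable {p : ℕ} [Fact p.Prime] {d : ℤ}

/-- `2 ≠ 0` and `d ≠ 0` in `𝔽_p` for `p ∤ 6d`. [folklore] -/
theorem two_ne_zero_and_of_not_dvd (hpd : ¬ (p : ℤ) ∣ 6 * d) :
    (2 : ZMod p) ≠ 0 ∧ (3 : ZMod p) ≠ 0 ∧ ((d : ℤ) : ZMod p) ≠ 0 := by
  refine ⟨fun h ↦ hpd ?_, fun h ↦ hpd ?_, fun h ↦ hpd ?_⟩
  · have : (p : ℤ) ∣ 2 := by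
      have := (ZMod.intCast_zmod_eq_zero_iff_dvd 2 p).mp (by exact_mod_cast h)
      exact_mod_cast this
    exact this.trans ⟨3 * d, by ring⟩
  · have : (p : ℤ) ∣ 3 := by
      have := (ZMod.intCast_zmod_eq_zero_iff_dvd 3 p).mp (by exact_mod_cast h)
      exact_mod_cast this
    exact this.trans ⟨2 * d, by ring⟩
  · exact ((ZMod.intCast_zmod_eq_zero_iff_dvd d p).mp h).mul_left 6

end Residues

/-! ## Counting points over a finite field, and over `𝔽₂` -/

section PointCount


/-- Over a finite field, `#W(F) = 1 + #{(x, y) ∈ F² on the curve}` for an elliptic `W` (every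
solution of the equation is a nonsingular point; Mathlib's `nonsingularPointEquiv`). [folklore] -/
theorem natCard_point_eq_one_add_card {F : Type*} [Field F] [Fintype F] [DecidableEq F]
    (W : WeierstrassCurve F) (hΔ : W.Δ ≠ 0) :
    Nat.card W.toAffine.Point = 1 + Fintype.card {xy : F × F //
      xy.2 ^ 2 + W.a₁ * xy.1 * xy.2 + W.a₃ * xy.2 = xy.1 ^ 3 + W.a₂ * xy.1 ^ 2 + W.a₄ * xy.1 + W.a₆} := by
  haveI : W.IsElliptic := ⟨isUnit_iff_ne_zero.mpr hΔ⟩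
  have e : W.toAffine.Point ≃ Option {xy : F × F // W.toAffine.Nonsingular xy.1 xy.2} :=
    WeierstrassCurve.Affine.nonsingularPointEquiv W.toAffine
  rw [Nat.card_congr e, Nat.card_eq_fintype_card, Fintype.card_option, add_comm]
  congr 1
  refine Fintype.card_congr (Equiv.subtypeEquivRight fun xy => ?_)
  rw [← WeierstrassCurve.Affine.equation_iff_nonsingular, WeierstrassCurve.Affine.equation_iff]

/-- `y² + xy = x³ + x² + αx + (α + 1)` over `𝔽₂` has exactly two points (`O` and `(0, α + 1)`).
[folklore] -/
theorem natCard_point_F2_two (x : ZMod 2) :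
    Nat.card (⟨1, 1, 0, x, x + 1⟩ : WeierstrassCurve (ZMod 2)).toAffine.Point = 2 := by
  fin_cases x <;> (rw [natCard_point_eq_one_add_card _ (by decide)]; decide)

/-- `y² + xy + y = x³ + x² + αx` over `𝔽₂` has exactly four points. [folklore] -/
theorem natCard_point_F2_four (x : ZMod 2) :
    Nat.card (⟨1, 1, 1, x, 0⟩ : WeierstrassCurve (ZMod 2)).toAffine.Point = 4 := by
  fin_cases x <;> (rw [natCard_point_eq_one_add_card _ (by decide)]; decide)

end PointCount

/-! ## The local polynomial at `2` from an explicit `2`-integral model with odd discriminant -/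

section GoodAtTwo


variable (v : HeightOneSpectrum (𝓞 ℚ))

/-- **Good reduction at `2` read off an explicit model.** If `C • W = M_ℚ` for a `ℤ`-model `M`
with odd discriminant, then the local polynomial of `W` at the place over `2` is
`1 - (3 - #M(𝔽₂))T + 2T²` (invariance of the local polynomial under `C`, the tree's
`localPolynomial_smul`, and `localPolynomial_map_of_not_dvd`). Silverman VII.1.3, VII.5.1(a).
[cite: SilvermanAEC2009, VII.1 Rem. 1.1 and Prop. VII.1.3(b)] -/
theorem localPolynomial_two_of_model (hv : natGenerator v = 2) (W : WeierstrassCurve ℚ)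
    [W.IsElliptic] (M : WeierstrassCurve ℤ) (C : VariableChange ℚ)
    (hC : C • W = M.map (Int.castRingHom ℚ)) (hΔ : ¬ (2 : ℤ) ∣ M.Δ) :
    (W.baseChange (v.adicCompletion ℚ)).localPolynomial (v.adicCompletionIntegers ℚ) =
      1 - Polynomial.C (3 - (Nat.card (M.map (Int.castRingHom (ZMod 2))).toAffine.Point : ℤ)) * X +
        Polynomial.C 2 * X ^ 2 := by
  have h := localPolynomial_map_of_not_dvd v M (by rw [hv]; exact_mod_cast hΔ)
  rw [hv] at h
  have hs : ((C • W).baseChange (v.adicCompletion ℚ)).localPolynomial (v.adicCompletionIntegers ℚ) =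
      (W.baseChange (v.adicCompletion ℚ)).localPolynomial (v.adicCompletionIntegers ℚ) := by
    simp only [WeierstrassCurve.baseChange, ← map_variableChange]
    exact localPolynomial_smul _ _ _
  rw [← hs, hC, h]
  norm_num

end GoodAtTwo

end WeierstrassCurve
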